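import Summits.KontsevichZagierPeriods.Zeta5Search.LaiSweepShard

/-!
# `κ₃` sweep certificate — shard file 126 of 127 (shards 882–888 of 889)

HONEST FRAMING. Systematic search; no irrationality claim unless certified. This file only checks,
by `decide +kernel`, shards 882–888 of the order-cell sweep of the `κ₃` point `(74, 2180, 444; δ74)`
(engine `LaiSweepEngine`, soundness `LaiSweepJump/Free/Eval/Shard/Kappa3`; a shard is `⟨regime, n,
p, q, p', q', Lo, Up⟩`: `n` cells from `p/q` to `p'/q'` with integer rate sums in `[Lo, Up]`, `K =
128`, `D = 2^40`). It draws NO conclusion: only the capstone `LaiKappa3SweepCert`, which needs all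
127 shard files, does. Kernel cost of this file ≈ 524 cells × 0.3 s.
-/

namespace Summit.KontsevichZagierPeriods.Zeta5Search.Sweep

set_option maxHeartbeats 100000000 in
/-- Shard 882: 80 cells of regime B from `4763/4804` to `404/407`.
[cite: Lai2024BallRivoal, §4 Lemma 4.3] -/
theorem shard882 :
    Shard.check 128 (2^40)
      ⟨true, 80, 4763, 4804, 404, 407, 9214343278672, 16777508177333⟩ = true := by
  decide +kernel

set_option maxHeartbeats 100000000 in
/-- Shard 883: 80 cells of regime B from `404/407` to `161/162`.
[cite: Lai2024BallRivoal, §4 Lemma 4.3] -/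
theorem shard883 :
    Shard.check 128 (2^40)
      ⟨true, 80, 404, 407, 161, 162, 9480254679493, 17278072323634⟩ = true := by
  decide +kernel

set_option maxHeartbeats 100000000 in
/-- Shard 884: 80 cells of regime B from `161/162` to `397/399`.
[cite: Lai2024BallRivoal, §4 Lemma 4.3] -/
theorem shard884 :
    Shard.check 128 (2^40)
      ⟨true, 80, 161, 162, 397, 399, 9169641582970, 16727793399522⟩ = true := by
  decide +kernel

set_option maxHeartbeats 100000000 in
/-- Shard 885: 80 cells of regime B from `397/399` to `254/255`.
[cite: Lai2024BallRivoal, §4 Lemma 4.3] -/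
theorem shard885 :
    Shard.check 128 (2^40)
      ⟨true, 80, 397, 399, 254, 255, 8590592425747, 15685639217742⟩ = true := by
  decide +kernel

set_option maxHeartbeats 100000000 in
/-- Shard 886: 80 cells of regime B from `254/255` to `330/331`.
[cite: Lai2024BallRivoal, §4 Lemma 4.3] -/
theorem shard886 :
    Shard.check 128 (2^40)
      ⟨true, 80, 254, 255, 330, 331, 7105653228176, 12984644344588⟩ = true := by
  decide +kernel

set_option maxHeartbeats 100000000 in
/-- Shard 887: 80 cells of regime B from `330/331` to `407/408`.
[cite: Lai2024BallRivoal, §4 Lemma 4.3] -/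
theorem shard887 :
    Shard.check 128 (2^40)
      ⟨true, 80, 330, 331, 407, 408, 4498353477282, 8224999444642⟩ = true := by
  decide +kernel

set_option maxHeartbeats 100000000 in
/-- Shard 888: 44 cells of regime B from `407/408` to `1/1`.
[cite: Lai2024BallRivoal, §4 Lemma 4.3] -/
theorem shard888 :
    Shard.check 128 (2^40)
      ⟨true, 44, 407, 408, 1, 1, 19244750137139, 35232658084226⟩ = true := by
  decide +kernel

/-- The checked shards of this file, in order. [folklore] -/
def shards126 : List (CheckedShard 128 (2^40)) :=
  [⟨_, shard882⟩, ⟨_, shard883⟩, ⟨_, shard884⟩, ⟨_, shard885⟩, ⟨_, shard886⟩,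
    ⟨_, shard887⟩, ⟨_, shard888⟩]

end Summit.KontsevichZagierPeriods.Zeta5Search.Sweep
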